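import Summits.QuantumFields.BalabanUV.T4Continuum.Support.ClusterRepOfDomains
import Literature.MathematicalPhysics.QuantumFieldTheory.Balaban1983to89.T4ActivityRecursion

/-!
# NE5 ∕ U3, route P2 — leaf L03 IN B13's LETTERS for the domain-geometry cluster representation: `KPInflated` from a
# (2.38)-shaped majorant, (1.26), the volume bound (2.30) and footprint locality (skeleton `t4/skeletons/NE5-t4-ne5-p2.md` §5
# row O1′ R-KP, generic part)

Cell `pub-balaban`, unit `b2b-balaban-t4-ne5-p2-g17` (T⁴ fan-out NE5 ∕ node U3, PROVER seat P2 «polymer-activity Lipschitz route»).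
Summits-side new work under the LEAN PLACEMENT RULE (cell bookkeeping over landed leaves; NOT a Literature module).  HONEST FRAMING:
rung (B)+1 of the FINITE-VOLUME T⁴ continuum programme — NOT infinite volume, NOT a mass gap, NOT the Clay problem, NOT a proof of
NE5 (NOT PRINTED in [Balaban1987RG1]–[Balaban1989LargeFieldII]; they print ε-UNIFORM bounds, never η-RATES).  HONEST DEPENDENCY (cell
line, verbatim): continuum YM on T⁴ ⇐ BetaPertH ∧ nine spine estimates (0/9 proved); BetaPertH ⇐ (D1) ∧ (D4) ∧ CAP+tail; G-an2-4
gates asym, D1 and NE2/3/4.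

WHAT THIS FILE DOES.  Leaf L03 of the activity route is the binder `T4ActivityRecursion.KPInflated R W m s a d`: the one-run majorant
`m`, INFLATED by `1 + s`, obeys the `d`-weighted Kotecký–Preiss condition with size function `a` in every step volume.  For the
representation built from the carriers' domain geometry (`ClusterRepOfDomains.DomainGeometry.clusterRep`, p207086: polymers =
domains, `inc` = same scale ∧ footprints touch, `vol X = level (scale X)`), this file PROVES it — the transplant of the tree's
certificate `B13Resummation.kp_condition` ((2.38) ⇒ [KP86] (1) in the printed letters) to the route's carrier — from:
* a nonnegative (2.38)-SHAPED majorant `m g U Z ≤ A·e^{−R·dlen Z}` on every step volume ([Balaban1988RG2Cluster] Lemma 3 (2.38) p. 20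
  *"|H(Z)| ≤ C₃ε₁ exp(−(1 − 8δ)½Lκ d_{k+1}(Z))"* — a hypothesis SHAPE with locator, asserted nowhere);
* footprint LOCALITY of the touching relation through a `reach` (`touch (cubes Z′) (cubes Z)` forces `Z′` to contain a cube of
  `reach Z`, `#reach Z ≤ ν·#cubes Z`; ν = 9 in four dimensions for "shares a cube or a wall");
* (1.26) p. 8 at every level (`B13FamilySum.Ineq126 (level k)`, rate `κ₀`, constant `K₀`) and the additive volume bound (2.30) p. 18
  (`B13FamilySum.VolBound (level k)`, `#cubes Z ≤ c₁(1 + dlen Z)`) — hypothesis SHAPES with locators;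
* the rate room `κ₀ + σ + τc₁ ≤ R` ("κ sufficiently large") and the smallness `(1 + s)·A·e^{b+τc₁}·K₀·ν ≤ τ` ("ε₁ sufficiently small",
  with the route's inflation `1 + s` folded in — the "one more ε₁-halving" of the skeleton, now an explicit inequality):
`kpInflated_of_majorant`: `KPInflated (G.clusterRep ρA ρB) W m s (fun Z => τ·#cubes Z) (fun Z => σ·dlen Z + b)`.
So O1′ R-KP for Bałaban's step = READ A, R from (2.38), κ₀, K₀, c₁ from (1.26)∕(2.30), ν from the lattice, and check two
inequalities (cell `SMALLNESS.md`); nothing of the manuscripts under audit is asserted.  0 sorry; no new axioms.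
-/

open scoped BigOperators

namespace Summit.QuantumFields.BalabanUV.T4Continuum.ClusterRepKP

open Literature.Probability.LatticeModels (sum_biUnion_le_sum_of_nonneg)
open Literature.MathematicalPhysics.QuantumFieldTheory.Balaban1983to89.T4OutputRate (Carriers)
open Literature.MathematicalPhysics.QuantumFieldTheory.Balaban1983to89.T4ActivityRecursion (KPInflated)
open Literature.MathematicalPhysics.QuantumFieldTheory.Balaban1983to89.B13FamilySum (Ineq126 VolBound)
open Summit.QuantumFields.BalabanUV.T4Continuum.ClusterRepOfDomains (DomainGeometry)

variable {C : Carriers} [DecidableEq C.Dom] {Cube : Type*} [DecidableEq Cube] (G : DomainGeometry C Cube)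

/-- [folklore] **L03 IN B13's LETTERS FOR THE DOMAIN-GEOMETRY REPRESENTATION.**  A (2.38)-shaped majorant on every step volume,
footprint locality of the touching relation through `reach` with `#reach ≤ ν·#cubes`, (1.26) and the volume bound (2.30) at every
level, the rate room `κ₀ + σ + τc₁ ≤ R` and the smallness `(1 + s)·A·e^{b+τc₁}·K₀·ν ≤ τ` give `KPInflated` for the inflated
majorant with `a Z = τ·#cubes Z`, `d Z = σ·dlen Z + b` (the transplant of `B13Resummation.kp_condition`). -/
theorem kpInflated_of_majorant (ρA ρB : (ℕ → ℝ) → C.BgB → C.Dom → ℂ) {W : Set (ℕ → ℝ)}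
    {m : (ℕ → ℝ) → C.BgB → C.Dom → ℝ} (reach : C.Dom → Finset Cube) (dlen : C.Dom → ℝ)
    {A R κ₀ K₀ c₁ τ σ b ν s : ℝ}
    (hloc : ∀ Z Z', G.touch (G.cubes Z') (G.cubes Z) → ∃ q ∈ reach Z, q ∈ G.cubes Z')
    (hreach : ∀ Z, ((reach Z).card : ℝ) ≤ ν * (G.cubes Z).card)
    (hd : ∀ Z, 0 ≤ dlen Z) (hA : 0 ≤ A) (hK₀ : 0 ≤ K₀) (hτ : 0 ≤ τ) (hσ : 0 ≤ σ) (hb : 0 ≤ b) (hs : 0 ≤ s)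
    (hm0 : ∀ (g : ℕ → ℝ) (U : C.BgB) (Z : C.Dom), 0 ≤ m g U Z)
    (hm : ∀ g ∈ W, ∀ (U : C.BgB) (k : ℕ), ∀ Z ∈ G.level k, m g U Z ≤ A * Real.exp (-(R * dlen Z)))
    (h126 : ∀ k, Ineq126 (G.level k) G.cubes dlen κ₀ K₀) (hvol : ∀ k, VolBound (G.level k) G.cubes dlen c₁)
    (hrate : κ₀ + σ + τ * c₁ ≤ R) (hsmall : (1 + s) * A * Real.exp (b + τ * c₁) * K₀ * ν ≤ τ) :
    KPInflated (G.clusterRep ρA ρB) W m s (fun Z => τ * ((G.cubes Z).card : ℝ)) (fun Z => σ * dlen Z + b) := by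
  refine ⟨fun Z => mul_nonneg hτ (Nat.cast_nonneg _), fun Z => add_nonneg (mul_nonneg hσ (hd Z)) hb, ?_⟩
  intro g hg U X Z hZ
  -- unfold the representation: the step volume is the level of `X`, the incompatibility is same-scale ∧ touch
  change ∑ Z' ∈ (G.level (C.scale X)).filter (fun Z' => G.inc Z' Z),
      (1 + s) * m g U Z' * Real.exp (τ * ((G.cubes Z').card : ℝ) + (σ * dlen Z' + b)) ≤ τ * ((G.cubes Z).card : ℝ)
  set k := C.scale X with hk
  set f : C.Dom → ℝ := fun Z' => (1 + s) * m g U Z' * Real.exp (τ * ((G.cubes Z').card : ℝ) + (σ * dlen Z' + b)) with hf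
  have hZk : Z ∈ G.level k := hZ
  have h1s : 0 ≤ 1 + s := by linarith
  have hf0 : ∀ Z', 0 ≤ f Z' := fun Z' => mul_nonneg (mul_nonneg h1s (hm0 g U Z')) (Real.exp_nonneg _)
  -- footprint locality: every incompatible `Z'` of the level contains a cube of `reach Z`
  have hcover : (G.level k).filter (fun Z' => G.inc Z' Z) ⊆
      (reach Z).biUnion fun q => (G.level k).filter fun Z' => q ∈ G.cubes Z' := by
    intro Z' hZ'
    obtain ⟨hZ'k, hinc⟩ := Finset.mem_filter.1 hZ'
    obtain ⟨q, hq, hqZ'⟩ := hloc Z Z' hinc.2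
    exact Finset.mem_biUnion.2 ⟨q, hq, Finset.mem_filter.2 ⟨hZ'k, hqZ'⟩⟩
  -- the pointwise bound `f Z' ≤ (1+s) A e^{b + τ c₁} e^{-κ₀ dlen Z'}` on the level
  have hpt : ∀ Z' ∈ G.level k, f Z' ≤ (1 + s) * A * Real.exp (b + τ * c₁) * Real.exp (-(κ₀ * dlen Z')) := by
    intro Z' hZ'
    have hv : τ * ((G.cubes Z').card : ℝ) ≤ τ * (c₁ * (1 + dlen Z')) := mul_le_mul_of_nonneg_left (hvol k Z' hZ') hτ
    have hexp : -(R * dlen Z') + (τ * (c₁ * (1 + dlen Z')) + (σ * dlen Z' + b)) =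
        (b + τ * c₁) + -((R - τ * c₁ - σ) * dlen Z') := by ring
    calc f Z' ≤ (1 + s) * (A * Real.exp (-(R * dlen Z'))) * Real.exp (τ * (c₁ * (1 + dlen Z')) + (σ * dlen Z' + b)) :=
          mul_le_mul (mul_le_mul_of_nonneg_left (hm g hg U k Z' hZ') h1s) (Real.exp_le_exp.2 (by linarith))
            (Real.exp_nonneg _) (mul_nonneg h1s (mul_nonneg hA (Real.exp_nonneg _)))
      _ = (1 + s) * A * Real.exp (b + τ * c₁) * Real.exp (-((R - τ * c₁ - σ) * dlen Z')) := by
          rw [show (1 + s) * (A * Real.exp (-(R * dlen Z'))) * Real.exp (τ * (c₁ * (1 + dlen Z')) + (σ * dlen Z' + b))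
              = (1 + s) * A * (Real.exp (-(R * dlen Z')) * Real.exp (τ * (c₁ * (1 + dlen Z')) + (σ * dlen Z' + b))) by ring,
            ← Real.exp_add, hexp, Real.exp_add, ← mul_assoc]
      _ ≤ (1 + s) * A * Real.exp (b + τ * c₁) * Real.exp (-(κ₀ * dlen Z')) := by
          refine mul_le_mul_of_nonneg_left (Real.exp_le_exp.2 (neg_le_neg ?_))
            (mul_nonneg (mul_nonneg h1s hA) (Real.exp_nonneg _))
          exact mul_le_mul_of_nonneg_right (by linarith) (hd Z')
  -- (1.26) per anchoring cube
  have hq : ∀ q, ∑ Z' ∈ (G.level k).filter (fun Z' => q ∈ G.cubes Z'), f Z' ≤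
      (1 + s) * A * Real.exp (b + τ * c₁) * K₀ := fun q =>
    calc ∑ Z' ∈ (G.level k).filter (fun Z' => q ∈ G.cubes Z'), f Z'
        ≤ ∑ Z' ∈ (G.level k).filter (fun Z' => q ∈ G.cubes Z'),
            (1 + s) * A * Real.exp (b + τ * c₁) * Real.exp (-(κ₀ * dlen Z')) :=
          Finset.sum_le_sum fun Z' hZ' => hpt Z' (Finset.mem_filter.1 hZ').1
      _ = (1 + s) * A * Real.exp (b + τ * c₁) *
            ∑ Z' ∈ (G.level k).filter (fun Z' => q ∈ G.cubes Z'), Real.exp (-(κ₀ * dlen Z')) := by rw [Finset.mul_sum]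
      _ ≤ (1 + s) * A * Real.exp (b + τ * c₁) * K₀ :=
          mul_le_mul_of_nonneg_left (h126 k q) (mul_nonneg (mul_nonneg h1s hA) (Real.exp_nonneg _))
  calc ∑ Z' ∈ (G.level k).filter (fun Z' => G.inc Z' Z), f Z'
      ≤ ∑ Z' ∈ (reach Z).biUnion (fun q => (G.level k).filter fun Z' => q ∈ G.cubes Z'), f Z' :=
        Finset.sum_le_sum_of_subset_of_nonneg hcover fun Z' _ _ => hf0 Z'
    _ ≤ ∑ q ∈ reach Z, ∑ Z' ∈ (G.level k).filter (fun Z' => q ∈ G.cubes Z'), f Z' :=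
        sum_biUnion_le_sum_of_nonneg _ _ f hf0
    _ ≤ ∑ q ∈ reach Z, (1 + s) * A * Real.exp (b + τ * c₁) * K₀ := Finset.sum_le_sum fun q _ => hq q
    _ = ((reach Z).card : ℝ) * ((1 + s) * A * Real.exp (b + τ * c₁) * K₀) := by rw [Finset.sum_const, nsmul_eq_mul]
    _ ≤ ν * ((G.cubes Z).card : ℝ) * ((1 + s) * A * Real.exp (b + τ * c₁) * K₀) :=
        mul_le_mul_of_nonneg_right (hreach Z)
          (mul_nonneg (mul_nonneg (mul_nonneg h1s hA) (Real.exp_nonneg _)) hK₀)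
    _ = ((1 + s) * A * Real.exp (b + τ * c₁) * K₀ * ν) * ((G.cubes Z).card : ℝ) := by ring
    _ ≤ τ * ((G.cubes Z).card : ℝ) := mul_le_mul_of_nonneg_right hsmall (Nat.cast_nonneg _)

end Summit.QuantumFields.BalabanUV.T4Continuum.ClusterRepKP
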